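/-
Copyright (c) 2026 the pub-hodgecm-mathlib formalisation cell (harness21).  Prover seat hodgecm-mathlib-K2E1-p15 (g0), Track B ∕ K2-LIT «5Res», h413 = `stmt-HodgeConjecture-24833`,
line `K2_E1_TraceFormulaBeta`, route of record `HCCMUnconditional`; dealer K2E1-plan (g7) `hB` deal (12:59:39Z ∕ 13:03:44Z): the LOWER-HALF-PLANE self-dual model of the
Maass–Selberg strip bound (the consumer's `hB` asks `1 ≤ |Im z|`, both signs), over ★ p860112 `K2E1ChiMaassSelbergContinuedLowerCMTwo`.
-/
import Summits.HodgeConjecture.HodgeConjecture.Theorems.K2E1ChiScatteringBoundMaassSelbergOnBoxesU2   -- ★ T1-χ (K2E4-p11): `sqrt_le_mul_sqrt_of_box` (+ ★ Models helpers)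
import Summits.HodgeConjecture.HodgeConjecture.Theorems.K2E1ChiMaassSelbergContinuedLowerCMTwo        -- ★ p860112 (this seat): `poleControl_continued_chi_cm_two_of_family_lower_on'`
import HarnessLib

/-!
# K2·E1 — `K2E1ChiScatteringBoundSelfDualLowerCMTwo`: THE SELF-DUAL MAASS–SELBERG MODEL AND STRIP BOUND ON THE LOWER QUADRANT `D₁ ⊆ D⁻ = {½ < Re, Im < 0}` — the mirror of
# ★ T1-χ `K2E1ChiScatteringBoundMaassSelbergOnBoxesU2` §1 (for the `hB` letter, which asks `1 ≤ |Im z|` with BOTH signs)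

Track B ∕ K2-LIT, crux h413 = `stmt-HodgeConjecture-24833`; cell `hodgecm-mathlib`, squad K2, ENGINE E1.  THEOREMS ONLY (no `def`, no `instance`, no notation, no named-fact hypothesis, no
`sorry`); lane `--kind proof --supports stmt-HodgeConjecture-24833 --as helper` (count-neutral).  Closes no socket.

WHAT ([MoeglinWaldspurger1995, IV.3.12 (a)]).  ★ T1-χ `norm_le_of_family_selfDual_on'` bounds the continued scattering vector `ψ(z) = M(z, χ)φ` of a SELF-DUAL family on an open preconnected
`D₁ ⊆ D⁺` with two sub-tube boxes: `‖ψ z‖ ≤ B(σ₀, T)·‖φ‖` for `z ∈ D₁`, `Re z ≤ σ₀`, `1 ≤ |Im z|`.  The consumer's letter `hB` (★ `K2E1PseudoEisensteinContourShiftVector` :193) quantifies over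
`1 ≤ |Im z|`, so the lower half-plane is needed too: this file instantiates ★ p860112 `poleControl_continued_chi_cm_two_of_family_lower_on'` (reflection `z ↦ z̄` through the D⁺ heads) at the
self-dual brackets `B₂ = κm⟪ψ z′, φ⟫`, `B₃ = κm⟪φ, ψ z⟫`, `B₄ = κm⟪ψ z′, ψ z⟫`, `b = κm‖ψ‖²`, `a = κm‖φ‖²` (★ Models `real_mul_inner_self`, `differentiableOn_inner_conj_comp`,
`norm_sq_real_mul_inner_le`) and runs ★ T1-χ's box-to-strip algebra (`sqrt_le_mul_sqrt_of_box`).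
* §1 **`poleControl_continued_chi_cm_two_of_family_selfDual_lower_on'`** ((a1)∧(a2)∧(a3) for `κm‖ψ z‖²` at every `z ∈ D₁ ⊆ D⁻`),
  **`norm_le_of_family_selfDual_lower_on'`** (`‖ψ z‖ ≤ ((σ₀−½)T^{2(σ₀−½)} + √((σ₀−½)²T^{4(σ₀−½)} + T^{4(σ₀−½)}))·‖φ‖` for `Re z ≤ σ₀`, `1 ≤ |Im z|`) — the same constant as ★ T1-χ's.

HONEST LABEL: HC_CM is proved only modulo the 7 printed citations (2 remaining named inputs: hLiu418 = `stmt-HodgeConjecture-24832`, h413 = `stmt-HodgeConjecture-24833`) until rung 0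
closes; this file asserts no named fact, is conditional by construction on the relation letter `hrel`, and closes no socket.

## References
* [MoeglinWaldspurger1995] C. Mœglin, J.-L. Waldspurger, *Spectral decomposition and Eisenstein series* (1995), IV.2.3, IV.3.12 (a).
* [Arthur1980TraceFormulaII] J. Arthur, *A trace formula for reductive groups II*, Compositio Math. 40 (1980), §4.
-/

set_option autoImplicit false
set_option linter.dupNamespace false  -- the mandated namespace repeats the summit's segment (`HodgeConjecture.HodgeConjecture`)

noncomputable section

open Real Set Filter Topology
open scoped NNReal ComplexConjugate InnerProductSpace
open Summit.HodgeConjecture.HodgeConjecture.Cruxes.H413.K2E1ChiMaassSelbergContinuedModelsCMTwo (real_mul_inner_self differentiableOn_inner_conj_comp norm_sq_real_mul_inner_le)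
open Summit.HodgeConjecture.HodgeConjecture.Cruxes.H413.K2E1ChiMaassSelbergContinuedLowerCMTwo (poleControl_continued_chi_cm_two_of_family_lower_on')
open Summit.HodgeConjecture.HodgeConjecture.Cruxes.H413.K2E1ChiScatteringBoundMaassSelbergU2 (sqrt_le_mul_sqrt_of_box)

namespace Summit.HodgeConjecture.HodgeConjecture.Cruxes.H413.K2E1ChiScatteringBoundSelfDualLowerCMTwo

variable {V : Type*} [NormedAddCommGroup V] [InnerProductSpace ℂ V] {H : Type*} [NormedAddCommGroup H] [InnerProductSpace ℂ H]

/-- **THE SELF-DUAL MODEL ON `D₁ ⊆ D⁻`** — (a1)∧(a2)∧(a3) for `b(z) = κm‖ψ z‖²`, `a = κm‖φ‖²` at every `z ∈ D₁` (open preconnected `⊆ D⁻`, two sub-tube boxes `O₁, O₂'` with `1 < Re z′ < Re z`),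
from a Hilbert family `F` with the self-dual four-bracket relation on the sub-tube (★ p860112 `poleControl_continued_chi_cm_two_of_family_lower_on'` at the brackets of ★ Models §2).
[cite: MoeglinWaldspurger1995, IV.2.3, IV.3.12 (a)] [cite: Arthur1980TraceFormulaII, §4] -/
theorem poleControl_continued_chi_cm_two_of_family_selfDual_lower_on' {D₁ : Set ℂ} (hD₁ : IsOpen D₁) (hD₁c : IsPreconnected D₁) (hD₁sub : D₁ ⊆ {z : ℂ | 1 / 2 < z.re ∧ z.im < 0})
    {O₁ O₂' : Set ℂ} (hO₁ : IsOpen O₁) (hO₁ne : O₁.Nonempty) (hO₁D : O₁ ⊆ D₁) (hO₂' : IsOpen O₂') (hO₂'ne : O₂'.Nonempty) (hO₂'D : O₂' ⊆ D₁)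
    (hsep : ∀ z ∈ O₁, ∀ z' ∈ O₂', 1 < z'.re ∧ z'.re < z.re)
    {T cμ K κ m : ℝ} (hT : 1 ≤ T) (hcμ : 0 < cμ) (hK : 0 < K) (hκ : 0 < κ) (hm : 0 < m) {φ : V} (hφ : φ ≠ 0) {ψ : ℂ → V} (hψ : DifferentiableOn ℂ ψ D₁)
    (F : ℂ → H) (hFd : DifferentiableOn ℂ F D₁)
    (hrel : ∀ z ∈ D₁, ∀ z' ∈ D₁, 1 < z'.re → z'.re < z.re →
      ⟪F z', F z⟫_ℂ = ((cμ : ℝ) : ℂ) * (((K : ℝ) : ℂ) *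
        ((((T : ℝ) : ℂ) ^ (z + conj z' - 1) / (z + conj z' - 1)) * (((κ : ℝ) : ℂ) * (((m : ℝ) : ℂ) * ⟪φ, φ⟫_ℂ))
          + (((T : ℝ) : ℂ) ^ (z - conj z') / (z - conj z')) * (((κ : ℝ) : ℂ) * (((m : ℝ) : ℂ) * ⟪ψ z', φ⟫_ℂ))
          - (((T : ℝ) : ℂ) ^ (-(z - conj z')) / (z - conj z')) * (((κ : ℝ) : ℂ) * (((m : ℝ) : ℂ) * ⟪φ, ψ z⟫_ℂ))
          - (((T : ℝ) : ℂ) ^ (-(z + conj z' - 1)) / (z + conj z' - 1)) * (((κ : ℝ) : ℂ) * (((m : ℝ) : ℂ) * ⟪ψ z', ψ z⟫_ℂ)))))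
    {z : ℂ} (hz : z ∈ D₁) :
    Real.sqrt (κ * m * ‖ψ z‖ ^ 2) ≤ (z.re - 1 / 2) * T ^ (2 * (z.re - 1 / 2)) * Real.sqrt (κ * m * ‖φ‖ ^ 2) / |z.im| +
        Real.sqrt ((z.re - 1 / 2) ^ 2 * T ^ (4 * (z.re - 1 / 2)) * (κ * m * ‖φ‖ ^ 2) / z.im ^ 2 + (κ * m * ‖φ‖ ^ 2) * T ^ (4 * (z.re - 1 / 2))) ∧
      (∀ {x₁ x₂ η : ℝ}, 0 < x₁ → (z.re - 1 / 2) ∈ Set.Icc x₁ x₂ → 0 < η → η ≤ |z.im| →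
        κ * m * ‖ψ z‖ ^ 2 ≤ (x₂ * T ^ (2 * x₂) * Real.sqrt (κ * m * ‖φ‖ ^ 2) / η + Real.sqrt (x₂ ^ 2 * T ^ (4 * x₂) * (κ * m * ‖φ‖ ^ 2) / η ^ 2 + (κ * m * ‖φ‖ ^ 2) * T ^ (4 * x₂))) ^ 2) ∧
      (|z.im| ≤ 1 → κ * m * ‖ψ z‖ ^ 2 ≤ ((z.re - 1 / 2) * T ^ (2 * (z.re - 1 / 2)) * Real.sqrt (κ * m * ‖φ‖ ^ 2) +
        Real.sqrt ((z.re - 1 / 2) ^ 2 * T ^ (4 * (z.re - 1 / 2)) * (κ * m * ‖φ‖ ^ 2) + (κ * m * ‖φ‖ ^ 2) * T ^ (4 * (z.re - 1 / 2)))) ^ 2 / z.im ^ 2) := by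
  have hφn : 0 < ‖φ‖ := norm_pos_iff.2 hφ
  have ha : 0 < κ * m * ‖φ‖ ^ 2 := by positivity
  have hB₂ : DifferentiableOn ℂ (fun w : ℂ => ((κ : ℝ) : ℂ) * (((m : ℝ) : ℂ) * ⟪ψ (conj w), φ⟫_ℂ)) {w : ℂ | conj w ∈ D₁} :=
    ((differentiableOn_inner_conj_comp hD₁ hψ φ).const_mul _).const_mul _
  have hB₃ : DifferentiableOn ℂ (fun z : ℂ => ((κ : ℝ) : ℂ) * (((m : ℝ) : ℂ) * ⟪φ, ψ z⟫_ℂ)) D₁ :=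
    (((innerSL ℂ φ).differentiable.comp_differentiableOn hψ).const_mul _).const_mul _
  have hB₃₂ : ∀ z ∈ D₁, ((κ : ℝ) : ℂ) * (((m : ℝ) : ℂ) * ⟪φ, ψ z⟫_ℂ) = conj (((κ : ℝ) : ℂ) * (((m : ℝ) : ℂ) * ⟪ψ z, φ⟫_ℂ)) := fun z _ => by
    rw [map_mul, map_mul, Complex.conj_ofReal, Complex.conj_ofReal, inner_conj_symm]
  have hB₄₁ : ∀ z' ∈ D₁, DifferentiableOn ℂ (fun z : ℂ => ((κ : ℝ) : ℂ) * (((m : ℝ) : ℂ) * ⟪ψ z', ψ z⟫_ℂ)) D₁ := fun z' _ =>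
    (((innerSL ℂ (ψ z')).differentiable.comp_differentiableOn hψ).const_mul _).const_mul _
  have hB₄₂ : ∀ z ∈ D₁, DifferentiableOn ℂ (fun w : ℂ => ((κ : ℝ) : ℂ) * (((m : ℝ) : ℂ) * ⟪ψ (conj w), ψ z⟫_ℂ)) {w : ℂ | conj w ∈ D₁} := fun z _ =>
    ((differentiableOn_inner_conj_comp hD₁ hψ (ψ z)).const_mul _).const_mul _
  exact poleControl_continued_chi_cm_two_of_family_lower_on' hD₁ hD₁c hD₁sub hO₁ hO₁ne hO₁D hO₂' hO₂'ne hO₂'D hsep hT hcμ hK ha (b := fun z => κ * m * ‖ψ z‖ ^ 2) (fun z _ => by positivity)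
    (B₁ := ((κ : ℝ) : ℂ) * (((m : ℝ) : ℂ) * ⟪φ, φ⟫_ℂ)) (B₂ := fun z' => ((κ : ℝ) : ℂ) * (((m : ℝ) : ℂ) * ⟪ψ z', φ⟫_ℂ))
    (B₃ := fun z => ((κ : ℝ) : ℂ) * (((m : ℝ) : ℂ) * ⟪φ, ψ z⟫_ℂ)) (B₄ := fun z z' => ((κ : ℝ) : ℂ) * (((m : ℝ) : ℂ) * ⟪ψ z', ψ z⟫_ℂ))
    (real_mul_inner_self κ m φ) hB₂ hB₃ hB₃₂ hB₄₁ hB₄₂ (fun z _ => real_mul_inner_self κ m (ψ z)) (fun z _ => norm_sq_real_mul_inner_le hκ.le hm.le (ψ z) φ) F hFd hrel hz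

/-- **THE SELF-DUAL STRIP BOUND ON `D₁ ⊆ D⁻`**: `‖ψ z‖ ≤ ((σ₀−½)T^{2(σ₀−½)} + √((σ₀−½)²T^{4(σ₀−½)} + T^{4(σ₀−½)}))·‖φ‖` for `z ∈ D₁`, `Re z ≤ σ₀`, `1 ≤ |Im z|` — the (a2)-box at
`x₂ = σ₀ − ½`, `η = 1` and ★ T1-χ `sqrt_le_mul_sqrt_of_box`; the SAME constant as ★ `norm_le_of_family_selfDual_on'`. [cite: MoeglinWaldspurger1995, IV.3.12 (a)] -/
theorem norm_le_of_family_selfDual_lower_on' {D₁ : Set ℂ} (hD₁ : IsOpen D₁) (hD₁c : IsPreconnected D₁) (hD₁sub : D₁ ⊆ {z : ℂ | 1 / 2 < z.re ∧ z.im < 0})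
    {O₁ O₂' : Set ℂ} (hO₁ : IsOpen O₁) (hO₁ne : O₁.Nonempty) (hO₁D : O₁ ⊆ D₁) (hO₂' : IsOpen O₂') (hO₂'ne : O₂'.Nonempty) (hO₂'D : O₂' ⊆ D₁)
    (hsep : ∀ z ∈ O₁, ∀ z' ∈ O₂', 1 < z'.re ∧ z'.re < z.re)
    {T cμ K κ m : ℝ} (hT : 1 ≤ T) (hcμ : 0 < cμ) (hK : 0 < K) (hκ : 0 < κ) (hm : 0 < m) {φ : V} (hφ : φ ≠ 0) {ψ : ℂ → V} (hψ : DifferentiableOn ℂ ψ D₁)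
    (F : ℂ → H) (hFd : DifferentiableOn ℂ F D₁)
    (hrel : ∀ z ∈ D₁, ∀ z' ∈ D₁, 1 < z'.re → z'.re < z.re →
      ⟪F z', F z⟫_ℂ = ((cμ : ℝ) : ℂ) * (((K : ℝ) : ℂ) *
        ((((T : ℝ) : ℂ) ^ (z + conj z' - 1) / (z + conj z' - 1)) * (((κ : ℝ) : ℂ) * (((m : ℝ) : ℂ) * ⟪φ, φ⟫_ℂ))
          + (((T : ℝ) : ℂ) ^ (z - conj z') / (z - conj z')) * (((κ : ℝ) : ℂ) * (((m : ℝ) : ℂ) * ⟪ψ z', φ⟫_ℂ))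
          - (((T : ℝ) : ℂ) ^ (-(z - conj z')) / (z - conj z')) * (((κ : ℝ) : ℂ) * (((m : ℝ) : ℂ) * ⟪φ, ψ z⟫_ℂ))
          - (((T : ℝ) : ℂ) ^ (-(z + conj z' - 1)) / (z + conj z' - 1)) * (((κ : ℝ) : ℂ) * (((m : ℝ) : ℂ) * ⟪ψ z', ψ z⟫_ℂ)))))
    (σ₀ : ℝ) {z : ℂ} (hz : z ∈ D₁) (hz₂ : z.re ≤ σ₀) (ht : 1 ≤ |z.im|) :
    ‖ψ z‖ ≤ ((σ₀ - 1 / 2) * T ^ (2 * (σ₀ - 1 / 2)) + Real.sqrt ((σ₀ - 1 / 2) ^ 2 * T ^ (4 * (σ₀ - 1 / 2)) + T ^ (4 * (σ₀ - 1 / 2)))) * ‖φ‖ := by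
  obtain ⟨-, h2, -⟩ := poleControl_continued_chi_cm_two_of_family_selfDual_lower_on' hD₁ hD₁c hD₁sub hO₁ hO₁ne hO₁D hO₂' hO₂'ne hO₂'D hsep hT hcμ hK hκ hm hφ hψ F hFd hrel hz
  have hz₁ : 1 / 2 < z.re := (hD₁sub hz).1
  have hT0 : 0 < T := lt_of_lt_of_le one_pos hT
  have hx₂ : 0 ≤ σ₀ - 1 / 2 := by linarith
  have hkm : 0 < κ * m := mul_pos hκ hm
  have h := @h2 (z.re - 1 / 2) (σ₀ - 1 / 2) 1 (by linarith) ⟨le_rfl, by linarith⟩ one_pos ht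
  have h3 := sqrt_le_mul_sqrt_of_box (a := κ * m * ‖φ‖ ^ 2) hx₂ one_pos hT0 h
  simp only [div_one, one_pow] at h3
  have e1 : Real.sqrt (κ * m * ‖ψ z‖ ^ 2) = Real.sqrt (κ * m) * ‖ψ z‖ := by rw [Real.sqrt_mul hkm.le, Real.sqrt_sq (norm_nonneg _)]
  have e2 : Real.sqrt (κ * m * ‖φ‖ ^ 2) = Real.sqrt (κ * m) * ‖φ‖ := by rw [Real.sqrt_mul hkm.le, Real.sqrt_sq (norm_nonneg _)]
  rw [e1, e2] at h3
  have h4 : Real.sqrt (κ * m) * ‖ψ z‖ ≤ Real.sqrt (κ * m) *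
      (((σ₀ - 1 / 2) * T ^ (2 * (σ₀ - 1 / 2)) + Real.sqrt ((σ₀ - 1 / 2) ^ 2 * T ^ (4 * (σ₀ - 1 / 2)) + T ^ (4 * (σ₀ - 1 / 2)))) * ‖φ‖) := by
    calc Real.sqrt (κ * m) * ‖ψ z‖ ≤ _ := h3
      _ = _ := by ring
  exact le_of_mul_le_mul_left h4 (Real.sqrt_pos.2 hkm)

end Summit.HodgeConjecture.HodgeConjecture.Cruxes.H413.K2E1ChiScatteringBoundSelfDualLowerCMTwo

end
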